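import Summits.Ventures.Crystal3D.Theorems.StickyWulffConstantNoReconstructionGainConeBand
import Summits.Ventures.Crystal3D.StickySpheres.ContactGraph
import HarnessLib

/-!
# The steep-or-flat layer bound with a general steepness threshold (robust version)

HONEST FRAMING. Part of the venture `Summits/Ventures/Crystal3D` (cell `crystal3d-full`), helper
`--supports` the crux `NoReconstructionGain` (stmt-Ventures-19144, route
`route-Ventures-StickyWulffConstant`).  Companion of
`StickyWulffConstantNoReconstructionGainSteepFlat.lean` (threshold `√(2/3)`, the close-packed
layer spacing): here the steepness threshold is any `t ≥ 0` with `t² > 5/8`, in particular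
`t = 4/5 < √(2/3)`.  The point: with `t = 4/5` the steep-or-flat class
`{every bond has |Δz| ≤ 1/5 or |Δz| ≥ 4/5}` is OPEN around the layered films — every unit packing
obtained from a subset of ONE Barlow stacking (bonds `Δz ∈ {0, ±√(2/3)}`, `√(2/3) = 0.8165`) by
moving each ball by `< 0.008` keeps all bond inclinations in the class — so the layer bound and
the `(111)` no-gain rung hold on a neighbourhood of the tight configurations, i.e. they are
STABLE under small off-lattice perturbations (rumpling, buckling, strain, thermal disorder), not
merely exact on registered films.

* `three_mul_card_level_add_numContacts_le_of_threshold` — `3·#{i | (x i)₂ = c} + C(x) ≤ 6N` for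
  every level `c`, every `t ≥ 0` with `t² > 5/8`, every unit packing with bonds flat (`≤ 1/5`) or
  `t`-steep.
* `three_mul_card_level_add_numContacts_le_four_fifths` — the instance `t = 4/5`.

WHAT THIS IS NOT: the atom (oblique bonds `1/5 < |Δz| < 4/5` remain open); rung F-C1 not moved.
-/

noncomputable section

namespace Summit.Ventures.Crystal3D.Theorems

open Summit.Ventures.Crystal3D Finset Real
open scoped InnerProductSpace

/-- **The steep-or-flat layer bound, general steepness threshold.**  Let `t ≥ 0` with `t² > 5/8`
(any `t > 0.7906`; the cone lemma's range).  For a unit packing `x : Fin N → ℝ³` whose bonds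
have each `|Δz| ≤ 1/5` (flat) or `|Δz| ≥ t` (steep), and ANY height `c`:
`3 · #{i | (x i)₂ = c} + numContacts x ≤ 6 N`.  With `t = 4/5 < √(2/3)` the class is a
NEIGHBOURHOOD of the layered / Barlow films (bond inclinations may deviate by `≥ 0.016` in `Δz`
from `0` and `±√(2/3)`), so the bound — and the no-gain rung built on it — is robust under every
small off-lattice perturbation of every Barlow film, not only exact on them.
Proof: as for `three_mul_card_level_add_numContacts_le` (flat partners `≤ 6` by the band lemma;
steep bonds charged to the endpoint farther from the level, `≤ 3` per ball by the cone lemma with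
this `t`, none at the level). -/
theorem three_mul_card_level_add_numContacts_le_of_threshold {N : ℕ}
    (x : Fin N → (EuclideanSpace ℝ (Fin 3))) (hx : IsUnitPacking x) (t : ℝ) (ht0 : 0 ≤ t)
    (ht : 5 / 8 < t ^ 2)
    (hsf : ∀ i j, dist (x i) (x j) = 1 → |x i 2 - x j 2| ≤ 1 / 5 ∨ t ≤ |x i 2 - x j 2|) (c : ℝ) :
    3 * (univ.filter fun i => x i 2 = c).card + numContacts x ≤ 6 * N := by
  classical
  have h23 : (5 : ℝ) / 8 < t ^ 2 := ht
  have h23pos : 0 < t := by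
    rcases eq_or_lt_of_le ht0 with h | h
    · rw [← h] at ht; norm_num at ht
    · exact h
  have hinjx := hx.injective
  -- unit bond vectors and their separation
  have hunit : ∀ i j, dist (x i) (x j) = 1 → ‖x j - x i‖ = 1 := by
    intro i j h; rw [← dist_eq_norm, dist_comm]; exact h
  have hsep : ∀ i j j', dist (x i) (x j) = 1 → dist (x i) (x j') = 1 → j ≠ j' →
      ⟪x j - x i, x j' - x i⟫_ℝ ≤ 1 / 2 := by
    intro i j j' hj hj' hne
    refine inner_le_half_of_one_le_dist (hunit i j hj) (hunit i j' hj') ?_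
    rw [dist_eq_norm, sub_sub_sub_cancel_right, ← dist_eq_norm]
    exact hx hne
  -- ordered touching pairs
  set P : Finset (Fin N × Fin N) :=
    univ.filter fun p => p.1 ≠ p.2 ∧ dist (x p.1) (x p.2) = 1 with hP
  have hPcard : P.card = 2 * numContacts x := by
    rw [← sum_coordination_eq, hP, card_filter, Fintype.sum_prod_type]
    refine sum_congr rfl fun i _ => ?_
    rw [coordination, contactNeighbors, card_filter]
    refine sum_congr rfl fun j _ => ?_
    by_cases hij : j = i
    · subst hij; simp
    · simp [hij, Ne.symm hij]
  set Pflat := P.filter fun p => |x p.1 2 - x p.2 2| ≤ 1 / 5 with hPflat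
  set Psteep := P.filter fun p => ¬ |x p.1 2 - x p.2 2| ≤ 1 / 5 with hPsteep
  have hsplit : P.card = Pflat.card + Psteep.card :=
    (card_filter_add_card_filter_not (s := P) _).symm
  have hsteep_of : ∀ p ∈ Psteep, t ≤ |x p.1 2 - x p.2 2| := by
    intro p hp
    rw [hPsteep, mem_filter, hP, mem_filter] at hp
    exact (hsf p.1 p.2 hp.1.2.2).resolve_left hp.2
  -- the injection `p ↦ x p.2 − x p.1` on a fibre `p.1 = i`
  have hfib_inj : ∀ (S : Finset (Fin N × Fin N)) (i : Fin N), (∀ p ∈ S, p.1 = i) →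
      Set.InjOn (fun p : Fin N × Fin N => x p.2 - x p.1) ↑S := by
    intro S i hS p hp q hq hpq
    have hp1 := hS p (mem_coe.1 hp)
    have hq1 := hS q (mem_coe.1 hq)
    simp only [hp1, hq1, sub_left_inj] at hpq
    exact Prod.ext (hp1.trans hq1.symm) (hinjx hpq)
  -- FLAT pairs: at most six per ball
  have hflat : Pflat.card ≤ 6 * N := by
    have hmaps : ((Pflat : Set (Fin N × Fin N))).MapsTo Prod.fst (univ : Finset (Fin N)) :=
      fun p _ => mem_coe.2 (mem_univ _)
    rw [card_eq_sum_card_fiberwise hmaps]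
    have hle : ∀ i ∈ (univ : Finset (Fin N)), (Pflat.filter fun p => p.1 = i).card ≤ 6 := by
      intro i _
      set S := Pflat.filter fun p => p.1 = i with hS
      have hS1 : ∀ p ∈ S, p.1 = i := fun p hp => (mem_filter.1 hp).2
      have hSP : ∀ p ∈ S, p.1 ≠ p.2 ∧ dist (x p.1) (x p.2) = 1 := fun p hp => by
        have := (mem_filter.1 (mem_filter.1 hp).1).1
        rw [hP, mem_filter] at this; exact this.2
      rw [← card_image_of_injOn (hfib_inj S i hS1)]
      refine card_thin_band_le_six ?_ ?_ ?_
      · intro u hu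
        obtain ⟨p, hp, rfl⟩ := mem_image.1 hu
        exact hunit _ _ (hSP p hp).2
      · intro u hu
        obtain ⟨p, hp, rfl⟩ := mem_image.1 hu
        have h := (mem_filter.1 (mem_filter.1 hp).1).2
        rw [PiLp.sub_apply, abs_sub_comm]; exact h
      · intro u hu w hw huw
        obtain ⟨p, hp, rfl⟩ := mem_image.1 hu
        obtain ⟨q, hq, rfl⟩ := mem_image.1 hw
        rw [hS1 p hp, hS1 q hq]
        refine hsep i p.2 q.2 ?_ ?_ ?_
        · have := (hSP p hp).2; rwa [hS1 p hp] at this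
        · have := (hSP q hq).2; rwa [hS1 q hq] at this
        · intro h; apply huw; rw [hS1 p hp, hS1 q hq, h]
    calc ∑ i ∈ (univ : Finset (Fin N)), (Pflat.filter fun p => p.1 = i).card
        ≤ ∑ _i ∈ (univ : Finset (Fin N)), 6 := sum_le_sum hle
      _ = 6 * N := by simp [mul_comm]
  -- STEEP pairs: the charging tournament
  set charged : Fin N × Fin N → Prop := fun p =>
    |x p.2 2 - c| < |x p.1 2 - c| ∨ (|x p.2 2 - c| = |x p.1 2 - c| ∧ x p.2 2 < x p.1 2)
    with hcharged
  set A := Psteep.filter fun p => charged p with hA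
  set B := Psteep.filter fun p => ¬ charged p with hB
  have hAB : Psteep.card = A.card + B.card := (card_filter_add_card_filter_not (s := Psteep) _).symm
  -- `B` is the mirror image of `A`
  have hPsymm : ∀ p : Fin N × Fin N, p ∈ Psteep ↔ p.swap ∈ Psteep := by
    suffices h : ∀ p : Fin N × Fin N, p ∈ Psteep → p.swap ∈ Psteep from
      fun p => ⟨h p, fun h' => by simpa using h p.swap h'⟩
    intro p hp
    rw [hPsteep, mem_filter, hP, mem_filter] at hp ⊢
    refine ⟨⟨mem_univ _, hp.1.2.1.symm, by rw [dist_comm]; exact hp.1.2.2⟩, ?_⟩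
    rw [Prod.fst_swap, Prod.snd_swap, abs_sub_comm]; exact hp.2
  have hBA : B = A.image Prod.swap := by
    ext p
    rw [hB, mem_filter, mem_image]
    constructor
    · rintro ⟨hp, hnc⟩
      refine ⟨p.swap, ?_, Prod.swap_swap p⟩
      rw [hA, mem_filter]
      refine ⟨(hPsymm p).1 hp, ?_⟩
      have hst := hsteep_of p hp
      have hne : x p.1 2 ≠ x p.2 2 := by
        intro h; rw [h, sub_self, abs_zero] at hst; linarith
      simp only [hcharged, Prod.fst_swap, Prod.snd_swap] at hnc ⊢
      rcases lt_trichotomy |x p.1 2 - c| |x p.2 2 - c| with hlt | heq | hgt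
      · exact Or.inl hlt
      · right; refine ⟨heq, ?_⟩
        rcases lt_or_gt_of_ne hne with h1 | h1
        · exact h1
        · exact absurd (Or.inr ⟨heq.symm, h1⟩) hnc
      · exact absurd (Or.inl hgt) hnc
    · rintro ⟨q, hq, rfl⟩
      rw [hA, mem_filter] at hq
      refine ⟨(hPsymm q).1 hq.1, ?_⟩
      have hcq := hq.2
      simp only [hcharged, Prod.fst_swap, Prod.snd_swap] at hcq ⊢
      rintro (hlt | ⟨heq, hlt⟩)
      · rcases hcq with h | ⟨h, -⟩
        · exact absurd (hlt.trans h) (lt_irrefl _)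
        · rw [h] at hlt; exact lt_irrefl _ hlt
      · rcases hcq with h | ⟨-, h⟩
        · rw [heq] at h; exact lt_irrefl _ h
        · exact absurd (hlt.trans h) (lt_irrefl _)
  have hBcard : B.card = A.card := by
    rw [hBA, card_image_of_injective _ Prod.swap_injective]
  -- charged steep pairs: none at a ball on the level, at most three at any other ball
  set E := univ.filter fun i => x i 2 = c with hE
  have hAfib : ∀ i, (A.filter fun p => p.1 = i).card ≤ if x i 2 = c then 0 else 3 := by
    intro i
    set S := A.filter fun p => p.1 = i with hS
    have hS1 : ∀ p ∈ S, p.1 = i := fun p hp => (mem_filter.1 hp).2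
    have hSA : ∀ p ∈ S, p ∈ Psteep ∧ charged p := fun p hp => mem_filter.1 (mem_filter.1 hp).1
    have hSP : ∀ p ∈ S, p.1 ≠ p.2 ∧ dist (x p.1) (x p.2) = 1 := fun p hp => by
      have := (mem_filter.1 (hSA p hp).1).1
      rw [hP, mem_filter] at this; exact this.2
    -- side of the charged partners
    have hside : ∀ p ∈ S, (c < x i 2 → x p.2 2 - x i 2 ≤ -t) ∧
        (x i 2 < c → t ≤ x p.2 2 - x i 2) ∧ x i 2 ≠ c := by
      intro p hp
      obtain ⟨hps, hpc⟩ := hSA p hp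
      have hst := hsteep_of p hps
      rw [hS1 p hp] at hst
      simp only [hcharged, hS1 p hp] at hpc
      refine ⟨fun hci => ?_, fun hci => ?_, fun hci => ?_⟩
      · -- partner below
        rcases le_or_gt (x p.2 2) (x i 2) with hle | hgt
        · rw [abs_of_nonneg (by linarith)] at hst; linarith
        · exfalso
          rw [abs_of_nonpos (by linarith)] at hst
          have h1 : |x i 2 - c| = x i 2 - c := abs_of_pos (by linarith)
          have h2 : |x p.2 2 - c| = x p.2 2 - c := abs_of_pos (by linarith)
          rw [h1, h2] at hpc
          rcases hpc with h | ⟨h, h'⟩ <;> linarith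
      · -- partner above
        rcases le_or_gt (x i 2) (x p.2 2) with hle | hgt
        · rw [abs_of_nonpos (by linarith)] at hst; linarith
        · exfalso
          rw [abs_of_nonneg (by linarith)] at hst
          have h1 : |x i 2 - c| = c - x i 2 := by rw [abs_sub_comm]; exact abs_of_pos (by linarith)
          have h2 : |x p.2 2 - c| = c - x p.2 2 := by
            rw [abs_sub_comm]; exact abs_of_pos (by linarith)
          rw [h1, h2] at hpc
          rcases hpc with h | ⟨h, h'⟩ <;> linarith
      · -- no charge at the level
        rw [hci, sub_self, abs_zero] at hpc
        rcases hpc with h | ⟨h, h'⟩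
        · exact absurd h (not_lt.2 (abs_nonneg _))
        · have : x p.2 2 = c := by
            have := abs_eq_zero.1 h; linarith
          linarith
    split_ifs with hci
    · -- empty fibre
      rw [Nat.le_zero, card_eq_zero, eq_empty_iff_forall_notMem]
      intro p hp; exact (hside p hp).2.2 hci
    · rw [← card_image_of_injOn (hfib_inj S i hS1)]
      have hn : ∀ u ∈ S.image (fun p : Fin N × Fin N => x p.2 - x p.1), ‖u‖ = 1 := by
        intro u hu
        obtain ⟨p, hp, rfl⟩ := mem_image.1 hu
        exact hunit _ _ (hSP p hp).2
      have hsp : ∀ u ∈ S.image (fun p : Fin N × Fin N => x p.2 - x p.1),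
          ∀ w ∈ S.image (fun p : Fin N × Fin N => x p.2 - x p.1), u ≠ w → ⟪u, w⟫_ℝ ≤ 1 / 2 := by
        intro u hu w hw huw
        obtain ⟨p, hp, rfl⟩ := mem_image.1 hu
        obtain ⟨q, hq, rfl⟩ := mem_image.1 hw
        rw [hS1 p hp, hS1 q hq]
        refine hsep i p.2 q.2 ?_ ?_ ?_
        · have := (hSP p hp).2; rwa [hS1 p hp] at this
        · have := (hSP q hq).2; rwa [hS1 q hq] at this
        · intro h; apply huw; rw [hS1 p hp, hS1 q hq, h]
      rcases lt_or_gt_of_ne hci with hlt | hgt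
      · refine card_cone_le_three (t) h23pos.le h23 hn ?_ hsp
        intro u hu
        obtain ⟨p, hp, rfl⟩ := mem_image.1 hu
        rw [PiLp.sub_apply, hS1 p hp]
        exact ((hside p hp).2.1 hlt)
      · refine card_negCone_le_three (t) h23pos.le h23 hn ?_ hsp
        intro u hu
        obtain ⟨p, hp, rfl⟩ := mem_image.1 hu
        rw [PiLp.sub_apply, hS1 p hp]
        exact ((hside p hp).1 hgt)
  have hAcard : A.card + 3 * E.card ≤ 3 * N := by
    have hmaps : ((A : Set (Fin N × Fin N))).MapsTo Prod.fst (univ : Finset (Fin N)) :=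
      fun p _ => mem_coe.2 (mem_univ _)
    rw [card_eq_sum_card_fiberwise hmaps]
    have h1 : ∑ i ∈ (univ : Finset (Fin N)), (A.filter fun p => p.1 = i).card ≤
        ∑ i ∈ (univ : Finset (Fin N)), (if x i 2 = c then 0 else 3) := sum_le_sum fun i _ => hAfib i
    have h2 : ∑ i ∈ (univ : Finset (Fin N)), (if x i 2 = c then 0 else 3) + 3 * E.card = 3 * N := by
      rw [← sum_filter_add_sum_filter_not univ (fun i => x i 2 = c)]
      rw [sum_congr rfl (fun i hi => if_pos (mem_filter.1 hi).2),
        sum_congr rfl (fun i hi => if_neg (mem_filter.1 hi).2)]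
      simp only [sum_const_zero, zero_add, sum_const, smul_eq_mul, mul_comm _ 3]
      rw [hE, ← mul_add, add_comm, card_filter_add_card_filter_not, card_univ,
        Fintype.card_fin]
    omega
  -- assemble
  show 3 * E.card + numContacts x ≤ 6 * N
  omega


/-- **The robust instance `t = 4/5`.**  For a unit packing whose bonds have each `|Δz| ≤ 1/5`
or `|Δz| ≥ 4/5`, and any height `c`: `3 · #{i | (x i)₂ = c} + numContacts x ≤ 6 N`. -/
theorem three_mul_card_level_add_numContacts_le_four_fifths {N : ℕ}
    (x : Fin N → (EuclideanSpace ℝ (Fin 3))) (hx : IsUnitPacking x)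
    (hsf : ∀ i j, dist (x i) (x j) = 1 → |x i 2 - x j 2| ≤ 1 / 5 ∨ 4 / 5 ≤ |x i 2 - x j 2|)
    (c : ℝ) : 3 * (univ.filter fun i => x i 2 = c).card + numContacts x ≤ 6 * N :=
  three_mul_card_level_add_numContacts_le_of_threshold x hx (4 / 5) (by norm_num) (by norm_num)
    hsf c

end Summit.Ventures.Crystal3D.Theorems

end
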